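import Literature.Geometry.Lorentzian.GaussianBeamData
import Literature.Geometry.Lorentzian.GaussianBeamAmplitude
import Literature.Geometry.Lorentzian.GaussianBeamEnergyDensity
import HarnessLib

/-!
# The explicit Gaussian beam: transport coefficient, admissible amplitudes, the beam function
(trunk G08 = T-LORENTZ, geometric optics; namespace `Literature.Geometry.Lorentzian.GaussianBeam`)

Continuation of `GaussianBeamData.lean` (Sbierski, Anal. PDE 8 (2015), §3 = arXiv:1311.2477v2
§2.2): for beam data `D : BeamData G V J`,

* `BeamData.q = □φ(X)/(2κ)`, `BeamData.A₀ = ampCore q` and their smoothness on `J`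
  (`contDiffOn_opTrace`, `contDiffOn_q`, `contDiffOn_A₀`);
* `BeamAmp D T` — **an admissible amplitude** for the time range `[0, T]`: `a ∈ C^∞_c(E4, ℂ)`
  with `tsupport a ⊆ V ∩ {x⁰ ∈ J}`, agreeing with `x ↦ A₀(x⁰)` near every `X(t)` for `t` in the
  open range `(−η, T + η) ⊆ J` (Sbierski's `a_𝒩 = a · χ`, `χ ≡ 1` near `γ`, `supp a_𝒩 ⊆ 𝒩`);
* `BeamAmp.beamC = a e^{iλφ}`, `BeamAmp.beam = Re(a e^{iλφ})` (third remark after the theorem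
  of §4), their smoothness, supports, and **the first derivatives**
  `∂_ν beam = Re(e^{iλφ}(∂_νa + iλ a ∂_νφ))` everywhere (`fderiv_beam_apply`), whence the pointwise
  form of the `T(dt,dt)`-density of the real beam (`normalCurrent_beam`,
  from `GaussianBeamEnergyDensity.normalCurrent_re_beam`);
* `contDiff_of_support_subset` — a function `C^n` on an open `U` whose support lies in a closed
  `K ⊆ U` is `C^n` (used for `□a`, `□φ · a`, … which are only defined sensibly near `supp a`).

## References

* J. Sbierski, *Characterisation of the energy of Gaussian beams on Lorentzian manifolds: with
  applications to black hole spacetimes*, Anal. PDE 8 (2015) 1379–1420, §3, §4 (third remark);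
  arXiv:1311.2477v2 §2.2–§2.3 (key `Sbierski2015`).
-/

noncomputable section

open Set Filter Complex
open scoped ContDiff Topology

namespace Literature.Geometry.Lorentzian

namespace GaussianBeam

open KerrSchild

/-! ### Functions smooth near a closed set containing their support -/

/-- **A function `C^n` on an open set `U`, whose support lies in a closed `K ⊆ U`, is `C^n`.**
[folklore] -/
theorem contDiff_of_support_subset {F : Type*} [NormedAddCommGroup F] [NormedSpace ℝ F]
    {W : Type*} [NormedAddCommGroup W] [NormedSpace ℝ W] {n : ℕ∞ω} {f : W → F} {K U : Set W}
    (hK : IsClosed K) (hKU : K ⊆ U) (hU : IsOpen U) (hf : ContDiffOn ℝ n f U)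
    (hs : Function.support f ⊆ K) : ContDiff ℝ n f := by
  rw [contDiff_iff_contDiffAt]
  intro x
  by_cases hx : x ∈ K
  · exact hf.contDiffAt (hU.mem_nhds (hKU hx))
  · have hzero : f =ᶠ[𝓝 x] fun _ ↦ 0 := by
      filter_upwards [hK.isOpen_compl.mem_nhds hx] with y hy
      exact Function.notMem_support.1 fun h ↦ hy (hs h)
    exact contDiffAt_const.congr_of_eventuallyEq hzero

namespace BeamData

variable {G : E4 → Fin 4 → Fin 4 → ℝ} {V : Set E4} {J : Set ℝ} (D : BeamData G V J)

/-- The transport coefficient `q = □φ(X)/(2κ)`. [cite: Sbierski2015, §3 (3.10)] -/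
def q (t : ℝ) : ℂ := opTrace G D.P D.M D.c t / (2 * D.κ t)

/-- The amplitude along the curve, `A₀ = exp(−∫₀ᵗ q)`. [cite: Sbierski2015, §3 (3.10)] -/
def A₀ : ℝ → ℂ := ampCore D.q

/-- **The transport coefficient `□φ(X(t))` is `C^∞` on `J`.** [cite: Sbierski2015, §3 (3.10)] -/
theorem contDiffOn_opTrace : ContDiffOn ℝ ∞ (opTrace G D.P D.M D.c) J := by
  unfold opTrace
  refine ContDiffOn.sum fun μ _ ↦ ContDiffOn.sum fun ν _ ↦ ?_
  refine ((Complex.ofRealCLM.contDiff.comp_contDiffOn (D.contDiffOn_dG_X μ μ ν)).mul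
    (Complex.ofRealCLM.contDiff.comp_contDiffOn (D.hP ν))).add
    ((Complex.ofRealCLM.contDiff.comp_contDiffOn (D.contDiffOn_coeff_X μ ν)).mul (D.hM μ ν))

/-- `q` is `C^∞` on `J`. [folklore] -/
theorem contDiffOn_q : ContDiffOn ℝ ∞ D.q J := by
  have hinv : ContDiffOn ℝ ∞ (fun t ↦ (2 * D.κ t)⁻¹) J :=
    (contDiffOn_const.mul D.hκ).inv fun t ht ↦ by
      have := (D.hκpos t ht).ne'
      positivity
  have h : ContDiffOn ℝ ∞ (fun t ↦ opTrace G D.P D.M D.c t * (((2 * D.κ t)⁻¹ : ℝ) : ℂ)) J :=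
    D.contDiffOn_opTrace.mul (Complex.ofRealCLM.contDiff.comp_contDiffOn hinv)
  refine h.congr fun t _ ↦ ?_
  simp only [q, div_eq_mul_inv]
  push_cast
  ring

/-- `q = □φ(X)/(2κ)` pointwise. [folklore] -/
theorem q_eq (t : ℝ) : D.q t = opTrace G D.P D.M D.c t / (2 * D.κ t) := rfl

/-- `A₀` is `C^∞` on `J`. [folklore] -/
theorem contDiffOn_A₀ : ContDiffOn ℝ ∞ D.A₀ J :=
  contDiffOn_ampCore D.q D.hJ D.hJc D.h0 D.contDiffOn_q

/-- `Ȧ₀ = −q A₀` on `J`. [cite: Sbierski2015, §3 (3.10)] -/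
theorem hasDerivAt_A₀ {t : ℝ} (ht : t ∈ J) : HasDerivAt D.A₀ (-D.q t * D.A₀ t) t :=
  hasDerivAt_ampCore D.q D.hJ D.hJc D.h0 D.contDiffOn_q ht

/-- `A₀(0) = 1`. [folklore] -/
theorem A₀_zero : D.A₀ 0 = 1 := ampCore_zero D.q

/-- `A₀ ≠ 0`. [folklore] -/
theorem A₀_ne_zero (t : ℝ) : D.A₀ t ≠ 0 := ampCore_ne_zero D.q t

/-- **The real transport law** `(|A₀|²)˙ = −(Re □φ(X)/κ) |A₀|²` on `J` (Sbierski's (firstcons)).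
[cite: Sbierski2015, §4 (proof of the theorem); arXiv v2 p. 16] -/
theorem hasDerivAt_normSq_A₀ {t : ℝ} (ht : t ∈ J) :
    HasDerivAt (fun u ↦ Complex.normSq (D.A₀ u))
      (-((opTrace G D.P D.M D.c t).re / D.κ t) * Complex.normSq (D.A₀ t)) t :=
  hasDerivAt_normSq_ampCore D.q D.hJ D.hJc D.h0 D.contDiffOn_q (fun t _ ↦ D.q_eq t)
    (fun t ht ↦ (D.hκpos t ht).ne') ht

end BeamData

/-! ### Admissible amplitudes and the beam -/

/-- **An admissible amplitude** for the beam data `D` on the time range `[0, T]`: a `C^∞`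
compactly supported `a : E4 → ℂ` supported inside `V ∩ {x⁰ ∈ J}`, which agrees with
`x ↦ A₀(x⁰)` near every curve point `X(t)` for `t` in an open range `(−η, T + η)` whose closure
lies in `J` (Sbierski's `a_𝒩 = a · χ`, `χ` a bump function equal to one near `γ`,
`supp a_𝒩 ⊆ 𝒩`). [cite: Sbierski2015, §3 (proof of the second lemma)] -/
structure BeamAmp {G : E4 → Fin 4 → Fin 4 → ℝ} {V : Set E4} {J : Set ℝ} (D : BeamData G V J)
    (T : ℝ) where
  /-- the amplitude -/
  amp : E4 → ℂ
  /-- the margin of the time range -/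
  η : ℝ
  hη : 0 < η
  hT0 : 0 ≤ T
  hTη : Icc (-η) (T + η) ⊆ J
  smooth : ContDiff ℝ ∞ amp
  compact : HasCompactSupport amp
  tsupp : tsupport amp ⊆ V ∩ {x : E4 | x 0 ∈ J}
  core : ∀ t ∈ Ioo (-η) (T + η), amp =ᶠ[𝓝 (D.X t)] fun y ↦ D.A₀ (y 0)

namespace BeamAmp

variable {G : E4 → Fin 4 → Fin 4 → ℝ} {V : Set E4} {J : Set ℝ} {D : BeamData G V J} {T : ℝ}
  (A : BeamAmp D T)

/-- `[0, T] ⊆ (−η, T + η)`. [folklore] -/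
theorem Icc_subset_Ioo : Icc (0 : ℝ) T ⊆ Ioo (-A.η) (T + A.η) := fun _ ht ↦
  ⟨by linarith [ht.1, A.hη], by linarith [ht.2, A.hη]⟩

/-- `[0, T] ⊆ J`. [folklore] -/
theorem Icc_subset (A : BeamAmp D T) : Icc (0 : ℝ) T ⊆ J := fun _ ht ↦
  A.hTη ⟨by linarith [ht.1, A.hη], by linarith [ht.2, A.hη]⟩

/-- `(−η, T + η) ⊆ J`. [folklore] -/
theorem Ioo_subset : Ioo (-A.η) (T + A.η) ⊆ J := fun _ ht ↦ A.hTη ⟨ht.1.le, ht.2.le⟩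

/-- The support of the amplitude lies in the slab over `J`. [folklore] -/
theorem tsupp_slab : tsupport A.amp ⊆ {x : E4 | x 0 ∈ J} := fun _ hx ↦ (A.tsupp hx).2

/-- The support of the amplitude lies in `V`. [folklore] -/
theorem tsupp_V : tsupport A.amp ⊆ V := fun _ hx ↦ (A.tsupp hx).1

/-- **The complex beam** `u_λ = a e^{iλφ}`. [cite: Sbierski2015, §3] -/
def beamC (lam : ℝ) (x : E4) : ℂ := A.amp x * cexp (I * lam * D.φ x)

/-- **The real beam** `Re(a e^{iλφ})` (third remark after the theorem of §4).
[cite: Sbierski2015, §4 (third remark after the theorem)] -/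
def beam (lam : ℝ) (x : E4) : ℝ := (A.beamC lam x).re

/-- Unfolding the real beam. [folklore] -/
theorem beam_apply (lam : ℝ) (x : E4) : A.beam lam x = (A.amp x * cexp (I * lam * D.φ x)).re := rfl

/-- The complex beam is `C^∞`. [folklore] -/
theorem contDiff_beamC (lam : ℝ) : ContDiff ℝ ∞ (A.beamC lam) :=
  contDiff_mul_of_tsupport (isOpen_slab D.hJ) A.smooth A.tsupp_slab
    ((contDiffOn_const.mul D.contDiffOn_φ).cexp)

/-- The real beam is `C^∞`. [folklore] -/
theorem contDiff_beam (lam : ℝ) : ContDiff ℝ ∞ (A.beam lam) :=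
  Complex.reCLM.contDiff.comp (A.contDiff_beamC lam)

/-- The complex beam is supported in the support of the amplitude. [folklore] -/
theorem support_beamC_subset (lam : ℝ) : Function.support (A.beamC lam) ⊆ Function.support A.amp :=
  fun x hx ↦ by
    simp only [Function.mem_support, beamC] at hx ⊢
    contrapose! hx
    simp [hx]

/-- The complex beam is supported in the support of the amplitude. [folklore] -/
theorem tsupport_beamC_subset (lam : ℝ) : tsupport (A.beamC lam) ⊆ tsupport A.amp :=
  closure_mono (A.support_beamC_subset lam)

/-- The real beam is supported in the support of the amplitude. [folklore] -/
theorem tsupport_beam_subset (lam : ℝ) : tsupport (A.beam lam) ⊆ tsupport A.amp :=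
  (closure_mono fun x hx ↦ by
    simp only [Function.mem_support, beam] at hx ⊢
    contrapose! hx
    simp [hx]).trans (A.tsupport_beamC_subset lam)

/-- The complex beam has compact support. [folklore] -/
theorem hasCompactSupport_beamC (lam : ℝ) : HasCompactSupport (A.beamC lam) :=
  IsCompact.of_isClosed_subset A.compact (isClosed_tsupport _) (A.tsupport_beamC_subset lam)

/-- The real beam has compact support. [folklore] -/
theorem hasCompactSupport_beam (lam : ℝ) : HasCompactSupport (A.beam lam) :=
  IsCompact.of_isClosed_subset A.compact (isClosed_tsupport _) (A.tsupport_beam_subset lam)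

/-- Off the support of the amplitude its coordinate derivatives vanish. [folklore] -/
theorem dC_amp_eq_zero {x : E4} (hx : x ∉ tsupport A.amp) (ν : Fin 4) : dC A.amp x ν = 0 := by
  have hzero : A.amp =ᶠ[𝓝 x] fun _ ↦ 0 := by
    filter_upwards [(isClosed_tsupport A.amp).isOpen_compl.mem_nhds hx] with y hy
    exact image_eq_zero_of_notMem_tsupport hy
  rw [dC, hzero.fderiv_eq]
  simp

/-- **The first derivatives of the real beam**: everywhere on the chart,
`∂_ν Re(a e^{iλφ}) = Re( e^{iλφ} (∂_νa + iλ a ∂_νφ) )` (off `supp a` both sides vanish).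
[cite: Sbierski2015, arXiv (2.9)] -/
theorem fderiv_beam_apply (lam : ℝ) (x : E4) (ν : Fin 4) :
    fderiv ℝ (A.beam lam) x (E4.basisVector ν) =
      (cexp (I * lam * D.φ x) * (dC A.amp x ν + I * lam * A.amp x * dC D.φ x ν)).re := by
  by_cases hx : x ∈ tsupport A.amp
  · have hxJ : x 0 ∈ J := A.tsupp_slab hx
    have hφd : DifferentiableAt ℝ D.φ x :=
      (D.contDiffOn_φ.contDiffAt ((isOpen_slab D.hJ).mem_nhds hxJ)).differentiableAt (by simp)
    have had : DifferentiableAt ℝ A.amp x := A.smooth.differentiable (by simp) x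
    have h1 : fderiv ℝ (A.beam lam) x (E4.basisVector ν) =
        (fderiv ℝ (A.beamC lam) x (E4.basisVector ν)).re :=
      fderiv_re_apply ((A.contDiff_beamC lam).differentiable (by simp) x) _
    rw [h1]
    change (dC (fun y ↦ A.amp y * cexp (I * lam * D.φ y)) x ν).re = _
    rw [dC_mul_cexp (I * lam) had hφd ν]
  · -- both sides vanish near `x`
    have hzero : A.beam lam =ᶠ[𝓝 x] fun _ ↦ 0 := by
      filter_upwards [(isClosed_tsupport A.amp).isOpen_compl.mem_nhds hx] with y hy
      have : A.amp y = 0 := image_eq_zero_of_notMem_tsupport hy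
      simp [beam, beamC, this]
    rw [hzero.fderiv_eq, A.dC_amp_eq_zero hx ν, image_eq_zero_of_notMem_tsupport hx]
    simp

/-- **The `T(dt,dt)`-density of the real beam**, pointwise:
`P⁰[Re(a e^{iλφ})](x) = ½ e^{-2λ Im φ(x)} Re densC(B, B̄) + ½ Re( e^{2iλφ(x)} densC(B, B) )`,
`B = ∂a + iλ a ∂φ` at `x`. [cite: Sbierski2015, §4 (proof of the theorem; third remark after it)] -/
theorem normalCurrent_beam (lam : ℝ) (x : E4) :
    normalCurrent G (A.beam lam) x 0 =
      2⁻¹ * Real.exp (-2 * lam * (D.φ x).im) *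
          (densC G x (beamB lam (dC A.amp x) (dC D.φ x) (A.amp x))
            (star (beamB lam (dC A.amp x) (dC D.φ x) (A.amp x)))).re +
        2⁻¹ * (cexp (2 * I * lam * D.φ x) *
          densC G x (beamB lam (dC A.amp x) (dC D.φ x) (A.amp x))
            (beamB lam (dC A.amp x) (dC D.φ x) (A.amp x))).re :=
  normalCurrent_re_beam G x lam (D.φ x) fun ν ↦ by
    rw [A.fderiv_beam_apply lam x ν, beamB]

end BeamAmp

end GaussianBeam

end Literature.Geometry.Lorentzian
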